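import Summits.QuantumFields.YangMills.Theorems.VirialFluxGapCentralField
import Summits.QuantumFields.YangMills.Theorems.VirialFluxGapCentralFieldCurveCalculus
import Summits.QuantumFields.YangMills.Theorems.VirialFluxGapRingDeficitFrameDerivative
import HarnessLib

/-!
# Route `VirialFluxGap` (YangMills): the explicit central field along the own frame curves of a wrap-block variable — derivatives of its three half-Pauli
# coordinates and their EXACT TRACE `3Re(c̄q) − N⁻¹(3 − |p|² + σq₀(z·p)/r) + (3/2)σq₀/N` (the per-variable divergence of `X_c = X_z + U`; central chart C1 of
# ⟨stmt-QuantumFields-24141⟩; free-hands helper)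

Width seat `ym-line-sfw-p2-w3` g59 (cell ym-idea-1, free hands), `--supports stmt-QuantumFields-24141`.

For a wrap-block variable `w = (i,(x,k))`, `x_k = −1`, of a ring history `P` on the central region (`|z_k(P)|² < ½`), and each half-Pauli direction `a`, this file
differentiates the `a`-th standard coordinate of the central direction (✓`centralDir`, ✓`centralCoeff`) along the own frame curve `s ↦ P·sliceCurve_{w, halfPauli a}(s)`:
* §0 letters: `pauliCoord_quatMatrix_im` (the coordinates of `quatMatrix(0,A)` are `(2A₂, 2A₁, 2A₀)`), `halfPauli_eq_quatMatrix` (`halfPauli a = quatMatrix(½u_{2−a})`),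
  `exists_sliceRead_clm` (the slot quaternion as a continuous linear map of the coordinates), `centralDir_inl_wrap` (the wrap-slot formula at all coordinates);
* §1 the two moving letters along the curve: ★ `hasDerivAt_blockIm_sliceCurve` (`ż_b = N⁻¹·Im_b(q·p)`, any direction `quatMatrix p`, via ✓`exists_bsliceCoeff_clm`) and
  ★ `hasDerivAt_sliceQuat_sliceCurve` (`q̇ = q·p`);
* §2 ★★ `hasDerivAt_centralCoord_wrap` — the derivative at `s = 0` of the `a`-th coordinate: `2·[Im_{b}(conj(D)·q + conj(c)·q·p_a) + ½σ ż_b]`, `b = 2 − a`,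
  `c = liftQuat σ z`, `D` the lift derivative (✓`hasDerivAt_anchoredEntry`; the clamp equals the lift near `s = 0`);
* §3 ★★★ `centralCoord_wrap_trace` — the SUM over `a` of these derivatives equals
  `3(σ√(1−|z|²)·q₀ + z·p) − N⁻¹(3q₀² + 2|p|² + σq₀(z·p)/√(1−|z|²)) + (3/2)·σ·q₀/N` (`q = (q₀,p) = su2Quat P_w`, `z = z_k(P)`, `N = #wrapBlock k`):
  frozen anchored profile `3Re(c̄q) ≤ 3` (✓`AnchoredProfile`) + base motion `−3/N + O((r₀²+ρ²)/N)` (✓`base_motion_trace`) + zero-mode part `(3/2)σRe q/N` (✓`BlockZeroModeField`).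
  With w2's `contDiff_centralCoeff` the left side is `Σ_a frameD (fixFrameStd (v,a)) (centralCoeff σ σ₄ (v,a)) (ringCoord P)` for `fixVar v = w` (§4, under a
  differentiability hypothesis: `centralDiv_wrap_eq`).

HONEST LABEL: calculus for ONE variable class (wrap-block slice variables; the seam and the plain variables are the same computation with `seamCurve` ∕ anchor `1`);
the sum over all variables, (E2) and (E1) are NOT here; ⟨24141⟩ and ⟨22884⟩ stay OPEN; the Yang–Mills mass gap is NOT proved by this; no summit is proved by a line.
THEOREMS ONLY (no `def`, no `sorry`).

References: [cite: CosteEtAl1985]; [cite: arXiv220412737, §2 (2.4) (p. 10)].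
-/

set_option autoImplicit false

noncomputable section

open scoped Matrix BigOperators Quaternion Topology
open Literature.MathematicalPhysics.QuantumFieldTheory hiding SU2
open Literature.MathematicalPhysics.QuantumLattice
open Literature.MathematicalPhysics.QuantumFieldTheory.SUNBakryEmery (matTop)

namespace Summit.QuantumFields.YangMills.Theorems.VirialFluxGap.CentralField

open Summit.QuantumFields.YangMills.Theorems.FemtoTransferGap
open Summit.QuantumFields.YangMills.Theorems.VirialFluxGap.RingDeficit
open Summit.QuantumFields.YangMills.Theorems.VirialFluxGap.FrameDerivative
open Summit.QuantumFields.YangMills.Theorems.VirialFluxGap.FrameHessian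
open Summit.QuantumFields.YangMills.Theorems.VirialFluxGap.FixFrame

variable {L : ℕ} [NeZero L]

open scoped Matrix.Norms.Frobenius

attribute [local instance 2000] Literature.MathematicalPhysics.QuantumFieldTheory.SUNBakryEmery.matTop

/-! ## §0 Letters -/

section Letters

omit [NeZero L]

/-- The half-Pauli coordinates of `quatMatrix(0, A₀, A₁, A₂)` are `(2A₂, 2A₁, 2A₀)`. [folklore] -/
theorem pauliCoord_quatMatrix_im (A₀ A₁ A₂ : ℝ) :
    pauliCoord (quatMatrix ⟨0, A₀, A₁, A₂⟩) 0 = 2 * A₂ ∧ pauliCoord (quatMatrix ⟨0, A₀, A₁, A₂⟩) 1 = 2 * A₁ ∧ pauliCoord (quatMatrix ⟨0, A₀, A₁, A₂⟩) 2 = 2 * A₀ := by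
  refine ⟨?_, ?_, ?_⟩ <;> simp [pauliCoord]

/-- The half-Pauli matrices are `quatMatrix` of half units: `halfPauli 0 = quatMatrix(0,0,0,½)`, `halfPauli 1 = quatMatrix(0,0,½,0)`, `halfPauli 2 = quatMatrix(0,½,0,0)`.
[folklore] -/
theorem halfPauli_eq_quatMatrix :
    halfPauli 0 = quatMatrix ⟨0, 0, 0, 1 / 2⟩ ∧ halfPauli 1 = quatMatrix ⟨0, 0, 1 / 2, 0⟩ ∧ halfPauli 2 = quatMatrix ⟨0, 1 / 2, 0, 0⟩ := by
  refine ⟨?_, ?_, ?_⟩ <;> (ext i j; fin_cases i <;> fin_cases j <;> simp [halfPauli, quatMatrix, Complex.ext_iff]) <;> norm_num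

/-- The read-off of a slot matrix times `quatMatrix p` on a ring history: `su2Quat(P_w)·p`. [folklore] -/
theorem readQuat_coe_mul_quatMatrix (U : SU2) (p : ℍ) : readQuat ((U : Matrix (Fin 2) (Fin 2) ℂ) * quatMatrix p) = su2Quat U * p := by
  rw [coe_mul_quatMatrix, readQuat_quatMatrix]

end Letters

/-- The slot quaternion as a continuous linear map of the coordinates. [folklore] -/
theorem exists_sliceRead_clm (i : Fin (2 * L - 1 + 1)) (e : Edge 3 L) :
    ∃ ρ : ((Fin (2 * L - 1 + 1) → Edge 3 L → Matrix (Fin 2) (Fin 2) ℂ) × (Site 3 L → Matrix (Fin 2) (Fin 2) ℂ)) →L[ℝ] ℍ, ∀ M, ρ M = readQuat (M.1 i e) :=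
  ⟨LinearMap.toContinuousLinearMap
    { toFun := fun M => readQuat (M.1 i e), map_add' := fun M N => by ext <;> simp [readQuat], map_smul' := fun c M => by ext <;> simp [readQuat] },
    fun _ => rfl⟩


/-- The wrap-slot formula of the central direction at ALL coordinates. [cite: CosteEtAl1985] -/
theorem centralDir_inl_wrap (σ : Fin 3 → ℝ) (σ₄ : ℝ)
    (M : (Fin (2 * L - 1 + 1) → Edge 3 L → Matrix (Fin 2) (Fin 2) ℂ) × (Site 3 L → Matrix (Fin 2) (Fin 2) ℂ))
    (i : Fin (2 * L - 1 + 1)) {x : Site 3 L} {k : Fin 3} (hx : x k = -1) :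
    centralDir L σ σ₄ M (Sum.inl (i, (x, k))) =
      quatMatrix ⟨0,
        anchoredIm (clampLift (σ k) (blockAvgM L k M)) (M.1 i (x, k)) 0 + (1 / 2 : ℝ) * σ k * blockAvgM L k M 0,
        anchoredIm (clampLift (σ k) (blockAvgM L k M)) (M.1 i (x, k)) 1 + (1 / 2 : ℝ) * σ k * blockAvgM L k M 1,
        anchoredIm (clampLift (σ k) (blockAvgM L k M)) (M.1 i (x, k)) 2 + (1 / 2 : ℝ) * σ k * blockAvgM L k M 2⟩ := by
  have htree : ¬(i = 0 ∧ treeEdge ((x, k) : Edge 3 L) = true) := fun h => not_treeEdge_of_wrap (e := (x, k)) hx h.2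
  rw [centralDir, if_neg htree, if_pos hx]

/-- The components of the anchored profile vector. [folklore] -/
theorem anchoredIm_components (c : ℍ) (X : Matrix (Fin 2) (Fin 2) ℂ) :
    anchoredIm c X 0 = (star c * readQuat X).imI ∧ anchoredIm c X 1 = (star c * readQuat X).imJ ∧ anchoredIm c X 2 = (star c * readQuat X).imK :=
  ⟨rfl, rfl, rfl⟩

/-! ## §1 The moving letters along a slice frame curve -/

/-- ★ **The block average along a slice frame curve**: for a block variable `(i,x) ∈ wrapBlock k` and any admissible direction `quatMatrix p`, each component
of `z_k` moves with velocity `N⁻¹·Im_b(su2Quat(P_w(t))·p)`, `N = #wrapBlock k`. [cite: arXiv220412737, §2 (2.4) (p. 10)] -/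
theorem hasDerivAt_blockIm_sliceCurve {k : Fin 3} {i : Fin (2 * L - 1 + 1)} {x : Site 3 L} (hx : x k = -1) (p : ℍ)
    (hY : (quatMatrix p)ᴴ = -quatMatrix p) (hY0 : (quatMatrix p).trace = 0)
    (P : (Fin (2 * L - 1 + 1) → GaugeConfig 3 L SU2) × (Site 3 L → SU2)) (t : ℝ) :
    HasDerivAt (fun s => blockIm L (wrapBlock L k) k (P * sliceCurve i (x, k) hY hY0 s) 0)
        ((su2Quat ((P * sliceCurve i (x, k) hY hY0 t).1 i (x, k)) * p).imI / ((wrapBlock L k).card : ℝ)) t ∧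
    HasDerivAt (fun s => blockIm L (wrapBlock L k) k (P * sliceCurve i (x, k) hY hY0 s) 1)
        ((su2Quat ((P * sliceCurve i (x, k) hY hY0 t).1 i (x, k)) * p).imJ / ((wrapBlock L k).card : ℝ)) t ∧
    HasDerivAt (fun s => blockIm L (wrapBlock L k) k (P * sliceCurve i (x, k) hY hY0 s) 2)
        ((su2Quat ((P * sliceCurve i (x, k) hY hY0 t).1 i (x, k)) * p).imK / ((wrapBlock L k).card : ℝ)) t := by
  have hS : (i, x) ∈ wrapBlock L k := (mem_wrapBlock k (i, x)).2 hx
  have key : ∀ b : Fin 3, HasDerivAt (fun s => blockIm L (wrapBlock L k) k (P * sliceCurve i (x, k) hY hY0 s) b)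
      ((![(su2Quat ((P * sliceCurve i (x, k) hY hY0 t).1 i (x, k)) * p).imI, (su2Quat ((P * sliceCurve i (x, k) hY hY0 t).1 i (x, k)) * p).imJ,
          (su2Quat ((P * sliceCurve i (x, k) hY hY0 t).1 i (x, k)) * p).imK] : Fin 3 → ℝ) b / ((wrapBlock L k).card : ℝ)) t := by
    intro b
    obtain ⟨ℓ, hℓ, hφ⟩ := exists_bsliceCoeff_clm (L := L) 2 (wrapBlock L k) k b
    have heq : (fun s => blockIm L (wrapBlock L k) k (P * sliceCurve i (x, k) hY hY0 s) b) =
        fun s => ℓ (ringCoord L (P * sliceCurve i (x, k) hY hY0 s)) := by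
      funext s
      rw [← hφ, bsliceCoeff_eq_blockIm]; ring
    rw [heq]
    have h := hasDerivAt_comp_ringCoord_sliceCurve (L := L) ℓ.contDiff i (x, k) hY hY0 P t
    refine h.congr_deriv ?_
    rw [ℓ.fderiv, hℓ, sum_imEntry_sliceTangent_block hS, imEntry_coe_mul_quatMatrix]
    ring
  refine ⟨?_, ?_, ?_⟩
  · simpa using key 0
  · simpa using key 1
  · simpa using key 2

/-- ★ **The slot quaternion along its own slice frame curve**: `d/ds su2Quat(P_w(s)) = su2Quat(P_w(s))·p`. [cite: arXiv220412737, §2 (2.4) (p. 10)] -/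
theorem hasDerivAt_sliceQuat_sliceCurve (i : Fin (2 * L - 1 + 1)) (e : Edge 3 L) (p : ℍ)
    (hY : (quatMatrix p)ᴴ = -quatMatrix p) (hY0 : (quatMatrix p).trace = 0)
    (P : (Fin (2 * L - 1 + 1) → GaugeConfig 3 L SU2) × (Site 3 L → SU2)) (t : ℝ) :
    HasDerivAt (fun s => su2Quat ((P * sliceCurve i e hY hY0 s).1 i e)) (su2Quat ((P * sliceCurve i e hY hY0 t).1 i e) * p) t := by
  obtain ⟨ρ, hρ⟩ := exists_sliceRead_clm (L := L) i e
  have heq : (fun s => su2Quat ((P * sliceCurve i e hY hY0 s).1 i e)) = fun s => ρ (ringCoord L (P * sliceCurve i e hY hY0 s)) := by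
    funext s; rw [hρ]; rfl
  rw [heq]
  have h := ρ.hasFDerivAt.comp_hasDerivAt t (hasDerivAt_ringCoord_sliceCurve i e hY hY0 P t)
  refine h.congr_deriv ?_
  show ρ (sliceTangent i e (quatMatrix p) (P * sliceCurve i e hY hY0 t)) = _
  rw [hρ]
  show readQuat (((P * sliceCurve i e hY hY0 t).1 i e : Matrix (Fin 2) (Fin 2) ℂ) * sliceDir i e (quatMatrix p) i e) = _
  rw [sliceDir_self, readQuat_coe_mul_quatMatrix]


/-! ## §2 The coordinates of the central direction along the own curve -/

omit [NeZero L] in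
/-- `sliceCurve` does not depend on the proofs, only on the direction. [folklore] -/
theorem sliceCurve_congr (i : Fin (2 * L - 1 + 1)) (e : Edge 3 L) {Y Y' : Matrix (Fin 2) (Fin 2) ℂ} (h : Y = Y') (hY : Yᴴ = -Y) (hY0 : Y.trace = 0)
    (hY' : Y'ᴴ = -Y') (hY0' : Y'.trace = 0) (s : ℝ) : sliceCurve i e hY hY0 s = sliceCurve i e hY' hY0' s := by
  subst h; rfl

/-- The own-curve value of the `a`-th coordinate of the central direction at a wrap-block variable, at every parameter: twice the `(2−a)`-th anchored entry.
[cite: CosteEtAl1985] -/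
theorem centralCoord_wrap_eq (σ : Fin 3 → ℝ) (σ₄ : ℝ) (Q : (Fin (2 * L - 1 + 1) → GaugeConfig 3 L SU2) × (Site 3 L → SU2))
    (i : Fin (2 * L - 1 + 1)) {x : Site 3 L} {k : Fin 3} (hx : x k = -1) :
    pauliCoord (centralDir L σ σ₄ (ringCoord L Q) (Sum.inl (i, (x, k)))) 0 =
      2 * ((star (clampLift (σ k) (blockIm L (wrapBlock L k) k Q)) * su2Quat (Q.1 i (x, k))).imK + (1 / 2 : ℝ) * σ k * blockIm L (wrapBlock L k) k Q 2) ∧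
    pauliCoord (centralDir L σ σ₄ (ringCoord L Q) (Sum.inl (i, (x, k)))) 1 =
      2 * ((star (clampLift (σ k) (blockIm L (wrapBlock L k) k Q)) * su2Quat (Q.1 i (x, k))).imJ + (1 / 2 : ℝ) * σ k * blockIm L (wrapBlock L k) k Q 1) ∧
    pauliCoord (centralDir L σ σ₄ (ringCoord L Q) (Sum.inl (i, (x, k)))) 2 =
      2 * ((star (clampLift (σ k) (blockIm L (wrapBlock L k) k Q)) * su2Quat (Q.1 i (x, k))).imI + (1 / 2 : ℝ) * σ k * blockIm L (wrapBlock L k) k Q 0) := by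
  rw [centralDir_inl_wrap σ σ₄ (ringCoord L Q) i hx, blockAvgM_ringCoord]
  obtain ⟨h0, h1, h2⟩ := pauliCoord_quatMatrix_im
    (anchoredIm (clampLift (σ k) (blockIm L (wrapBlock L k) k Q)) ((ringCoord L Q).1 i (x, k)) 0 + (1 / 2 : ℝ) * σ k * blockIm L (wrapBlock L k) k Q 0)
    (anchoredIm (clampLift (σ k) (blockIm L (wrapBlock L k) k Q)) ((ringCoord L Q).1 i (x, k)) 1 + (1 / 2 : ℝ) * σ k * blockIm L (wrapBlock L k) k Q 1)
    (anchoredIm (clampLift (σ k) (blockIm L (wrapBlock L k) k Q)) ((ringCoord L Q).1 i (x, k)) 2 + (1 / 2 : ℝ) * σ k * blockIm L (wrapBlock L k) k Q 2)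
  rw [h0, h1, h2]
  exact ⟨rfl, rfl, rfl⟩

/-- ★★ **The coordinates of the central direction along the own frame curve of a wrap-block variable.**  For `x_k = −1`, `|z_k(P)|² < ½` and an admissible
direction `quatMatrix p`, along `s ↦ P·sliceCurve_{(i,(x,k)),quatMatrix p}(s)` the three half-Pauli coordinates of the central direction at the variable are
differentiable at `s = 0` with derivatives `2·[Im_b(conj(D)·q + conj(c)·q·p) + ½σ_k ż_b]`, `b = 2, 1, 0`, where `q = su2Quat P_{i,(x,k)}`, `c = liftQuat σ_k z_k(P)`,
`ż_b = Im_b(q·p)/N`, and `D = (−σ_k(z·ż)/√(1−|z|²))•1 + Σ_b ż_b•u_b` the lift derivative. [cite: CosteEtAl1985] -/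
theorem hasDerivAt_centralCoord_wrap (σ : Fin 3 → ℝ) (σ₄ : ℝ) (P : (Fin (2 * L - 1 + 1) → GaugeConfig 3 L SU2) × (Site 3 L → SU2))
    (i : Fin (2 * L - 1 + 1)) {x : Site 3 L} {k : Fin 3} (hx : x k = -1)
    (hz : (blockIm L (wrapBlock L k) k P 0) ^ 2 + (blockIm L (wrapBlock L k) k P 1) ^ 2 + (blockIm L (wrapBlock L k) k P 2) ^ 2 < 1 / 2)
    (p : ℍ) (hY : (quatMatrix p)ᴴ = -quatMatrix p) (hY0 : (quatMatrix p).trace = 0) :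
    let z : Fin 3 → ℝ := blockIm L (wrapBlock L k) k P
    let q : ℍ := su2Quat (P.1 i (x, k))
    let dz : Fin 3 → ℝ := ![(q * p).imI / ((wrapBlock L k).card : ℝ), (q * p).imJ / ((wrapBlock L k).card : ℝ), (q * p).imK / ((wrapBlock L k).card : ℝ)]
    HasDerivAt (fun s => pauliCoord (centralDir L σ σ₄ (ringCoord L (P * sliceCurve i (x, k) hY hY0 s)) (Sum.inl (i, (x, k)))) 0)
        (2 * ((star ((-σ k * (z 0 * dz 0 + z 1 * dz 1 + z 2 * dz 2) / Real.sqrt (1 - ((z 0) ^ 2 + (z 1) ^ 2 + (z 2) ^ 2))) • (1 : ℍ) + dz 0 • zUnit 0 + dz 1 • zUnit 1 + dz 2 • zUnit 2) * q + star (liftQuat (σ k) z) * (q * p)).imK + (1 / 2 : ℝ) * σ k * dz 2)) 0 ∧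
    HasDerivAt (fun s => pauliCoord (centralDir L σ σ₄ (ringCoord L (P * sliceCurve i (x, k) hY hY0 s)) (Sum.inl (i, (x, k)))) 1)
        (2 * ((star ((-σ k * (z 0 * dz 0 + z 1 * dz 1 + z 2 * dz 2) / Real.sqrt (1 - ((z 0) ^ 2 + (z 1) ^ 2 + (z 2) ^ 2))) • (1 : ℍ) + dz 0 • zUnit 0 + dz 1 • zUnit 1 + dz 2 • zUnit 2) * q + star (liftQuat (σ k) z) * (q * p)).imJ + (1 / 2 : ℝ) * σ k * dz 1)) 0 ∧
    HasDerivAt (fun s => pauliCoord (centralDir L σ σ₄ (ringCoord L (P * sliceCurve i (x, k) hY hY0 s)) (Sum.inl (i, (x, k)))) 2)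
        (2 * ((star ((-σ k * (z 0 * dz 0 + z 1 * dz 1 + z 2 * dz 2) / Real.sqrt (1 - ((z 0) ^ 2 + (z 1) ^ 2 + (z 2) ^ 2))) • (1 : ℍ) + dz 0 • zUnit 0 + dz 1 • zUnit 1 + dz 2 • zUnit 2) * q + star (liftQuat (σ k) z) * (q * p)).imI + (1 / 2 : ℝ) * σ k * dz 0)) 0 := by
  intro z q dz
  -- the moving letters
  set γ := fun s => P * sliceCurve i (x, k) hY hY0 s with hγ
  have hγ0 : P * sliceCurve i (x, k) hY hY0 0 = P := by rw [sliceCurve_zero, mul_one]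
  obtain ⟨hz0, hz1, hz2⟩ := hasDerivAt_blockIm_sliceCurve (L := L) hx p hY hY0 P 0
  rw [hγ0] at hz0 hz1 hz2
  have hzb : ∀ b : Fin 3, HasDerivAt (fun s => blockIm L (wrapBlock L k) k (P * sliceCurve i (x, k) hY hY0 s) b) (dz b) 0 := by
    intro b; fin_cases b
    · simpa [dz] using hz0
    · simpa [dz] using hz1
    · simpa [dz] using hz2
  have hq := hasDerivAt_sliceQuat_sliceCurve (L := L) i (x, k) p hY hY0 P 0
  rw [hγ0] at hq
  have hlt : (blockIm L (wrapBlock L k) k (P * sliceCurve i (x, k) hY hY0 0) 0) ^ 2 + (blockIm L (wrapBlock L k) k (P * sliceCurve i (x, k) hY hY0 0) 1) ^ 2 +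
      (blockIm L (wrapBlock L k) k (P * sliceCurve i (x, k) hY hY0 0) 2) ^ 2 < 1 := by
    rw [hγ0]; linarith
  -- the anchored entries with the TRUE lift
  obtain ⟨hA1, hA2, hA3⟩ := hasDerivAt_anchoredEntry (σ k) (z := fun s => blockIm L (wrapBlock L k) k (P * sliceCurve i (x, k) hY hY0 s)) hzb hlt hq
  rw [hγ0] at hA1 hA2 hA3
  -- the clamp is the lift near `s = 0`
  have hcont : ∀ b : Fin 3, ContinuousAt (fun s => blockIm L (wrapBlock L k) k (P * sliceCurve i (x, k) hY hY0 s) b) 0 := fun b => (hzb b).continuousAt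
  have hev : ∀ᶠ s in 𝓝 (0 : ℝ), (blockIm L (wrapBlock L k) k (P * sliceCurve i (x, k) hY hY0 s) 0) ^ 2 +
      (blockIm L (wrapBlock L k) k (P * sliceCurve i (x, k) hY hY0 s) 1) ^ 2 + (blockIm L (wrapBlock L k) k (P * sliceCurve i (x, k) hY hY0 s) 2) ^ 2 < 1 / 2 := by
    have hc : ContinuousAt (fun s => (blockIm L (wrapBlock L k) k (P * sliceCurve i (x, k) hY hY0 s) 0) ^ 2 +
        (blockIm L (wrapBlock L k) k (P * sliceCurve i (x, k) hY hY0 s) 1) ^ 2 + (blockIm L (wrapBlock L k) k (P * sliceCurve i (x, k) hY hY0 s) 2) ^ 2) 0 :=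
      (((hcont 0).pow 2).add ((hcont 1).pow 2)).add ((hcont 2).pow 2)
    have h := hc.eventually_lt continuousAt_const (show _ < (1 / 2 : ℝ) by rw [hγ0]; exact hz)
    exact h
  have hclamp : ∀ᶠ s in 𝓝 (0 : ℝ), clampLift (σ k) (blockIm L (wrapBlock L k) k (P * sliceCurve i (x, k) hY hY0 s)) =
      liftQuat (σ k) (blockIm L (wrapBlock L k) k (P * sliceCurve i (x, k) hY hY0 s)) :=
    hev.mono fun s hs => clampLift_eq_liftQuat _ hs.le
  -- assemble each coordinate
  refine ⟨?_, ?_, ?_⟩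
  · have hG : HasDerivAt (fun s => 2 * ((star (liftQuat (σ k) (blockIm L (wrapBlock L k) k (P * sliceCurve i (x, k) hY hY0 s))) *
        su2Quat ((P * sliceCurve i (x, k) hY hY0 s).1 i (x, k))).imK + (1 / 2 : ℝ) * σ k * blockIm L (wrapBlock L k) k (P * sliceCurve i (x, k) hY hY0 s) 2))
        (2 * ((star ((-σ k * (z 0 * dz 0 + z 1 * dz 1 + z 2 * dz 2) / Real.sqrt (1 - ((z 0) ^ 2 + (z 1) ^ 2 + (z 2) ^ 2))) • (1 : ℍ) + dz 0 • zUnit 0 + dz 1 • zUnit 1 + dz 2 • zUnit 2) * q + star (liftQuat (σ k) z) * (q * p)).imK + (1 / 2 : ℝ) * σ k * dz 2)) 0 :=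
      (hA3.add ((hzb 2).const_mul _)).const_mul 2
    refine hG.congr_of_eventuallyEq ?_
    filter_upwards [hclamp] with s hs
    rw [(centralCoord_wrap_eq σ σ₄ _ i hx).1, hs]
  · have hG : HasDerivAt (fun s => 2 * ((star (liftQuat (σ k) (blockIm L (wrapBlock L k) k (P * sliceCurve i (x, k) hY hY0 s))) *
        su2Quat ((P * sliceCurve i (x, k) hY hY0 s).1 i (x, k))).imJ + (1 / 2 : ℝ) * σ k * blockIm L (wrapBlock L k) k (P * sliceCurve i (x, k) hY hY0 s) 1))
        (2 * ((star ((-σ k * (z 0 * dz 0 + z 1 * dz 1 + z 2 * dz 2) / Real.sqrt (1 - ((z 0) ^ 2 + (z 1) ^ 2 + (z 2) ^ 2))) • (1 : ℍ) + dz 0 • zUnit 0 + dz 1 • zUnit 1 + dz 2 • zUnit 2) * q + star (liftQuat (σ k) z) * (q * p)).imJ + (1 / 2 : ℝ) * σ k * dz 1)) 0 :=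
      (hA2.add ((hzb 1).const_mul _)).const_mul 2
    refine hG.congr_of_eventuallyEq ?_
    filter_upwards [hclamp] with s hs
    rw [(centralCoord_wrap_eq σ σ₄ _ i hx).2.1, hs]
  · have hG : HasDerivAt (fun s => 2 * ((star (liftQuat (σ k) (blockIm L (wrapBlock L k) k (P * sliceCurve i (x, k) hY hY0 s))) *
        su2Quat ((P * sliceCurve i (x, k) hY hY0 s).1 i (x, k))).imI + (1 / 2 : ℝ) * σ k * blockIm L (wrapBlock L k) k (P * sliceCurve i (x, k) hY hY0 s) 0))
        (2 * ((star ((-σ k * (z 0 * dz 0 + z 1 * dz 1 + z 2 * dz 2) / Real.sqrt (1 - ((z 0) ^ 2 + (z 1) ^ 2 + (z 2) ^ 2))) • (1 : ℍ) + dz 0 • zUnit 0 + dz 1 • zUnit 1 + dz 2 • zUnit 2) * q + star (liftQuat (σ k) z) * (q * p)).imI + (1 / 2 : ℝ) * σ k * dz 0)) 0 :=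
      (hA1.add ((hzb 0).const_mul _)).const_mul 2
    refine hG.congr_of_eventuallyEq ?_
    filter_upwards [hclamp] with s hs
    rw [(centralCoord_wrap_eq σ σ₄ _ i hx).2.2, hs]


/-! ## §3 The trace over the three directions -/

section Algebra

omit [NeZero L]

/-- ★★ **The trace identity (pure algebra)**: the sum of the three own-curve derivative values of §2 for the half-Pauli directions (`p_a = ½u_{2−a}`, coordinate
`a`) is `3(σ r q₀ + z·p) − N⁻¹(3q₀² + 2|p|² + σ r⁻¹ q₀ (z·p)) + (3/2)σq₀/N` (`r = √(1−|z|²) ≠ 0`, `N ≠ 0`): frozen anchored profile + base motion + zero-mode part.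
[cite: CosteEtAl1985] -/
theorem centralCoord_trace_algebra (q : ℍ) (z : Fin 3 → ℝ) (σ N : ℝ) (hN : N ≠ 0) (hr : Real.sqrt (1 - ((z 0) ^ 2 + (z 1) ^ 2 + (z 2) ^ 2)) ≠ 0) :
    2 * ((star ((-σ * (z 0 * (![(q * ((1 / 2 : ℝ) • zUnit 2)).imI / N, (q * ((1 / 2 : ℝ) • zUnit 2)).imJ / N, (q * ((1 / 2 : ℝ) • zUnit 2)).imK / N] : Fin 3 → ℝ) 0 + z 1 * (![(q * ((1 / 2 : ℝ) • zUnit 2)).imI / N, (q * ((1 / 2 : ℝ) • zUnit 2)).imJ / N, (q * ((1 / 2 : ℝ) • zUnit 2)).imK / N] : Fin 3 → ℝ) 1 + z 2 * (![(q * ((1 / 2 : ℝ) • zUnit 2)).imI / N, (q * ((1 / 2 : ℝ) • zUnit 2)).imJ / N, (q * ((1 / 2 : ℝ) • zUnit 2)).imK / N] : Fin 3 → ℝ) 2) / Real.sqrt (1 - ((z 0) ^ 2 + (z 1) ^ 2 + (z 2) ^ 2))) • (1 : ℍ) + (![(q * ((1 / 2 : ℝ) • zUnit 2)).imI / N, (q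 * ((1 / 2 : ℝ) • zUnit 2)).imJ / N, (q * ((1 / 2 : ℝ) • zUnit 2)).imK / N] : Fin 3 → ℝ) 0 • zUnit 0 + (![(q * ((1 / 2 : ℝ) • zUnit 2)).imI / N, (q * ((1 / 2 : ℝ) • zUnit 2)).imJ / N, (q * ((1 / 2 : ℝ) • zUnit 2)).imK / N] : Fin 3 → ℝ) 1 • zUnit 1 + (![(q * ((1 / 2 : ℝ) • zUnit 2)).imI / N, (q * ((1 / 2 : ℝ) • zUnit 2)).imJ / N, (q * ((1 / 2 : ℝ) • zUnit 2)).imK / N] : Fin 3 → ℝ) 2 • zUnit 2) * q + star (liftQuat σ z) * (q * ((1 / 2 : ℝ) • zUnit 2))).imK + (1 / 2 : ℝ) * σ * ((![(q * ((1 / 2 : ℝ) • zUnit 2)).imI / N, (q * ((1 / 2 : ℝ) • zUnit 2)).imJ / N, (q * ((1 / 2 : ℝ) • zUnit 2)).imK / N] : Fin 3 → ℝ) 2)) +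
    2 * ((star ((-σ * (z 0 * (![(q * ((1 / 2 : ℝ) • zUnit 1)).imI / N, (q * ((1 / 2 : ℝ) • zUnit 1)).imJ / N, (q * ((1 / 2 : ℝ) • zUnit 1)).imK / N] : Fin 3 → ℝ) 0 + z 1 * (![(q * ((1 / 2 : ℝ) • zUnit 1)).imI / N, (q * ((1 / 2 : ℝ) • zUnit 1)).imJ / N, (q * ((1 / 2 : ℝ) • zUnit 1)).imK / N] : Fin 3 → ℝ) 1 + z 2 * (![(q * ((1 / 2 : ℝ) • zUnit 1)).imI / N, (q * ((1 / 2 : ℝ) • zUnit 1)).imJ / N, (q * ((1 / 2 : ℝ) • zUnit 1)).imK / N] : Fin 3 → ℝ) 2) / Real.sqrt (1 - ((z 0) ^ 2 + (z 1) ^ 2 + (z 2) ^ 2))) • (1 : ℍ) + (![(q * ((1 / 2 : ℝ) • zUnit 1)).imI / N, (q * ((1 / 2 : ℝ) • zUnit 1)).imJ / N, (q * ((1 / 2 : ℝ) • zUnit 1)).imK / N] : Fin 3 → ℝ) 0 • zUnit 0 + (![(q * ((1 / 2 : ℝ) • zUnit 1)).imI / N, (q * ((1 / 2 : ℝ) •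 zUnit 1)).imJ / N, (q * ((1 / 2 : ℝ) • zUnit 1)).imK / N] : Fin 3 → ℝ) 1 • zUnit 1 + (![(q * ((1 / 2 : ℝ) • zUnit 1)).imI / N, (q * ((1 / 2 : ℝ) • zUnit 1)).imJ / N, (q * ((1 / 2 : ℝ) • zUnit 1)).imK / N] : Fin 3 → ℝ) 2 • zUnit 2) * q + star (liftQuat σ z) * (q * ((1 / 2 : ℝ) • zUnit 1))).imJ + (1 / 2 : ℝ) * σ * ((![(q * ((1 / 2 : ℝ) • zUnit 1)).imI / N, (q * ((1 / 2 : ℝ) • zUnit 1)).imJ / N, (q * ((1 / 2 : ℝ) • zUnit 1)).imK / N] : Fin 3 → ℝ) 1)) +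
    2 * ((star ((-σ * (z 0 * (![(q * ((1 / 2 : ℝ) • zUnit 0)).imI / N, (q * ((1 / 2 : ℝ) • zUnit 0)).imJ / N, (q * ((1 / 2 : ℝ) • zUnit 0)).imK / N] : Fin 3 → ℝ) 0 + z 1 * (![(q * ((1 / 2 : ℝ) • zUnit 0)).imI / N, (q * ((1 / 2 : ℝ) • zUnit 0)).imJ / N, (q * ((1 / 2 : ℝ) • zUnit 0)).imK / N] : Fin 3 → ℝ) 1 + z 2 * (![(q * ((1 / 2 : ℝ) • zUnit 0)).imI / N, (q * ((1 / 2 : ℝ) • zUnit 0)).imJ / N, (q * ((1 / 2 : ℝ) • zUnit 0)).imK / N] : Fin 3 → ℝ) 2) / Real.sqrt (1 - ((z 0) ^ 2 + (z 1) ^ 2 + (z 2) ^ 2))) • (1 : ℍ) + (![(q * ((1 / 2 : ℝ) • zUnit 0)).imI / N, (q * ((1 / 2 : ℝ) • zUnit 0)).imJ / N, (q * ((1 / 2 : ℝ) • zUnit 0)).imK / N] : Fin 3 → ℝ) 0 • zUnit 0 + (![(q * ((1 / 2 : ℝ) • zUnit 0)).imI / N, (q * ((1 / 2 : ℝ) •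 zUnit 0)).imJ / N, (q * ((1 / 2 : ℝ) • zUnit 0)).imK / N] : Fin 3 → ℝ) 1 • zUnit 1 + (![(q * ((1 / 2 : ℝ) • zUnit 0)).imI / N, (q * ((1 / 2 : ℝ) • zUnit 0)).imJ / N, (q * ((1 / 2 : ℝ) • zUnit 0)).imK / N] : Fin 3 → ℝ) 2 • zUnit 2) * q + star (liftQuat σ z) * (q * ((1 / 2 : ℝ) • zUnit 0))).imI + (1 / 2 : ℝ) * σ * ((![(q * ((1 / 2 : ℝ) • zUnit 0)).imI / N, (q * ((1 / 2 : ℝ) • zUnit 0)).imJ / N, (q * ((1 / 2 : ℝ) • zUnit 0)).imK / N] : Fin 3 → ℝ) 0)) =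
    3 * (σ * Real.sqrt (1 - ((z 0) ^ 2 + (z 1) ^ 2 + (z 2) ^ 2)) * q.re + (z 0 * q.imI + z 1 * q.imJ + z 2 * q.imK)) - (3 * q.re ^ 2 + 2 * (q.imI ^ 2 + q.imJ ^ 2 + q.imK ^ 2) + σ * (Real.sqrt (1 - ((z 0) ^ 2 + (z 1) ^ 2 + (z 2) ^ 2)))⁻¹ * q.re * (z 0 * q.imI + z 1 * q.imJ + z 2 * q.imK)) / N + (3 / 2 : ℝ) * σ * q.re / N := by
  simp only [Quaternion.imI_mul, Quaternion.imJ_mul, Quaternion.imK_mul, Quaternion.re_mul, Quaternion.re_star, Quaternion.imI_star, Quaternion.imJ_star,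
    Quaternion.imK_star, Quaternion.re_add, Quaternion.imI_add, Quaternion.imJ_add, Quaternion.imK_add, Quaternion.re_smul, Quaternion.imI_smul,
    Quaternion.imJ_smul, Quaternion.imK_smul, Quaternion.re_one, Quaternion.imI_one, Quaternion.imJ_one, Quaternion.imK_one, zUnit, liftQuat,
    Matrix.cons_val_zero, Matrix.cons_val_one, Matrix.head_cons, Matrix.cons_val_two, Matrix.tail_cons, smul_eq_mul, mul_zero, mul_one, add_zero,
    zero_add, sub_zero, zero_sub, mul_neg, neg_mul, neg_neg]
  field_simp
  ring

/-- The half units are admissible directions: `quatMatrix(½u_b)` is skew-Hermitian and traceless. [folklore] -/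
theorem quatMatrix_half_zUnit : ∀ b : Fin 3,
    (quatMatrix ((1 / 2 : ℝ) • zUnit b))ᴴ = -quatMatrix ((1 / 2 : ℝ) • zUnit b) ∧ (quatMatrix ((1 / 2 : ℝ) • zUnit b)).trace = 0
  | 0 => by
    have e : (1 / 2 : ℝ) • zUnit 0 = (⟨0, 1 / 2, 0, 0⟩ : ℍ) := by ext <;> simp [zUnit]
    rw [e]; exact ⟨quatMatrix_im_conjTranspose _ _ _, quatMatrix_im_trace _ _ _⟩
  | 1 => by
    have e : (1 / 2 : ℝ) • zUnit 1 = (⟨0, 0, 1 / 2, 0⟩ : ℍ) := by ext <;> simp [zUnit]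
    rw [e]; exact ⟨quatMatrix_im_conjTranspose _ _ _, quatMatrix_im_trace _ _ _⟩
  | 2 => by
    have e : (1 / 2 : ℝ) • zUnit 2 = (⟨0, 0, 0, 1 / 2⟩ : ℍ) := by ext <;> simp [zUnit]
    rw [e]; exact ⟨quatMatrix_im_conjTranspose _ _ _, quatMatrix_im_trace _ _ _⟩

/-- `halfPauli a = quatMatrix(½u_{2−a})`. [folklore] -/
theorem halfPauli_eq_quatMatrix_half_zUnit :
    halfPauli 0 = quatMatrix ((1 / 2 : ℝ) • zUnit 2) ∧ halfPauli 1 = quatMatrix ((1 / 2 : ℝ) • zUnit 1) ∧ halfPauli 2 = quatMatrix ((1 / 2 : ℝ) • zUnit 0) := by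
  obtain ⟨h0, h1, h2⟩ := halfPauli_eq_quatMatrix
  have e0 : (1 / 2 : ℝ) • zUnit 2 = (⟨0, 0, 0, 1 / 2⟩ : ℍ) := by ext <;> simp [zUnit]
  have e1 : (1 / 2 : ℝ) • zUnit 1 = (⟨0, 0, 1 / 2, 0⟩ : ℍ) := by ext <;> simp [zUnit]
  have e2 : (1 / 2 : ℝ) • zUnit 0 = (⟨0, 1 / 2, 0, 0⟩ : ℍ) := by ext <;> simp [zUnit]
  rw [e0, e1, e2]
  exact ⟨h0, h1, h2⟩

end Algebra

/-- ★★★ **The per-variable divergence of the explicit central field at a wrap-block variable, as own-curve derivatives.**  For `x_k = −1` and `|z_k(P)|² < ½`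
the three half-Pauli coordinates of `centralDir` along the own frame curves `P·sliceCurve_{(i,(x,k)), halfPauli a}` are differentiable at `0` with values `V₀, V₁, V₂`
whose sum is `3(σ_k r q₀ + z·p) − N⁻¹(3q₀² + 2|p|² + σ_k r⁻¹ q₀(z·p)) + (3/2)σ_k q₀/N`, `q = su2Quat P_{i,(x,k)}`, `z = blockIm (wrapBlock k) k P`, `r = √(1−|z|²)`,
`N = #wrapBlock k`.  (For unit `q`: `3q₀² + 2|p|² = 3 − |p|²`, and `3(σ_k r q₀ + z·p) = 3Re(c̄q) ≤ 3`.) [cite: CosteEtAl1985] -/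
theorem centralCoord_wrap_trace (σ : Fin 3 → ℝ) (σ₄ : ℝ) (P : (Fin (2 * L - 1 + 1) → GaugeConfig 3 L SU2) × (Site 3 L → SU2))
    (i : Fin (2 * L - 1 + 1)) {x : Site 3 L} {k : Fin 3} (hx : x k = -1)
    (hz : (blockIm L (wrapBlock L k) k P 0) ^ 2 + (blockIm L (wrapBlock L k) k P 1) ^ 2 + (blockIm L (wrapBlock L k) k P 2) ^ 2 < 1 / 2) :
    ∃ V₀ V₁ V₂ : ℝ,
      HasDerivAt (fun s => pauliCoord (centralDir L σ σ₄ (ringCoord L (P * sliceCurve i (x, k) (halfPauli_conjTranspose 0) (halfPauli_trace 0) s)) (Sum.inl (i, (x, k)))) 0) V₀ 0 ∧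
      HasDerivAt (fun s => pauliCoord (centralDir L σ σ₄ (ringCoord L (P * sliceCurve i (x, k) (halfPauli_conjTranspose 1) (halfPauli_trace 1) s)) (Sum.inl (i, (x, k)))) 1) V₁ 0 ∧
      HasDerivAt (fun s => pauliCoord (centralDir L σ σ₄ (ringCoord L (P * sliceCurve i (x, k) (halfPauli_conjTranspose 2) (halfPauli_trace 2) s)) (Sum.inl (i, (x, k)))) 2) V₂ 0 ∧
      V₀ + V₁ + V₂ = 3 * (σ k * Real.sqrt (1 - ((blockIm L (wrapBlock L k) k P 0) ^ 2 + (blockIm L (wrapBlock L k) k P 1) ^ 2 + (blockIm L (wrapBlock L k) k P 2) ^ 2)) * (su2Quat (P.1 i (x, k))).re + (blockIm L (wrapBlock L k) k P 0 * (su2Quat (P.1 i (x, k))).imI + blockIm L (wrapBlock L k) k P 1 * (su2Quat (P.1 i (x, k))).imJ + blockIm L (wrapBlock L k) k P 2 * (su2Quat (P.1 i (x, k))).imK)) - (3 * (su2Quat (P.1 i (x, k))).re ^ 2 + 2 * ((su2Quat (P.1 i (x, k))).imI ^ 2 + (su2Quat (P.1 i (x, k))).imJ ^ 2 + (su2Quat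 (P.1 i (x, k))).imK ^ 2) + σ k * (Real.sqrt (1 - ((blockIm L (wrapBlock L k) k P 0) ^ 2 + (blockIm L (wrapBlock L k) k P 1) ^ 2 + (blockIm L (wrapBlock L k) k P 2) ^ 2)))⁻¹ * (su2Quat (P.1 i (x, k))).re * (blockIm L (wrapBlock L k) k P 0 * (su2Quat (P.1 i (x, k))).imI + blockIm L (wrapBlock L k) k P 1 * (su2Quat (P.1 i (x, k))).imJ + blockIm L (wrapBlock L k) k P 2 * (su2Quat (P.1 i (x, k))).imK)) / ((wrapBlock L k).card : ℝ) + (3 / 2 : ℝ) * σ k * (su2Quat (P.1 i (x, k))).re / ((wrapBlock L k).card : ℝ) := by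
  obtain ⟨hY2, hY02⟩ := quatMatrix_half_zUnit 2
  obtain ⟨hY1, hY01⟩ := quatMatrix_half_zUnit 1
  obtain ⟨hY0, hY00⟩ := quatMatrix_half_zUnit 0
  obtain ⟨d0, -, -⟩ := hasDerivAt_centralCoord_wrap σ σ₄ P i hx hz ((1 / 2 : ℝ) • zUnit 2) hY2 hY02
  obtain ⟨-, d1, -⟩ := hasDerivAt_centralCoord_wrap σ σ₄ P i hx hz ((1 / 2 : ℝ) • zUnit 1) hY1 hY01
  obtain ⟨-, -, d2⟩ := hasDerivAt_centralCoord_wrap σ σ₄ P i hx hz ((1 / 2 : ℝ) • zUnit 0) hY0 hY00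
  obtain ⟨e0, e1, e2⟩ := halfPauli_eq_quatMatrix_half_zUnit
  rw [show (fun s => pauliCoord (centralDir L σ σ₄ (ringCoord L (P * sliceCurve i (x, k) hY2 hY02 s)) (Sum.inl (i, (x, k)))) 0) =
      fun s => pauliCoord (centralDir L σ σ₄ (ringCoord L (P * sliceCurve i (x, k) (halfPauli_conjTranspose 0) (halfPauli_trace 0) s)) (Sum.inl (i, (x, k)))) 0
      from funext fun s => by rw [sliceCurve_congr i (x, k) e0]] at d0
  rw [show (fun s => pauliCoord (centralDir L σ σ₄ (ringCoord L (P * sliceCurve i (x, k) hY1 hY01 s)) (Sum.inl (i, (x, k)))) 1) =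
      fun s => pauliCoord (centralDir L σ σ₄ (ringCoord L (P * sliceCurve i (x, k) (halfPauli_conjTranspose 1) (halfPauli_trace 1) s)) (Sum.inl (i, (x, k)))) 1
      from funext fun s => by rw [sliceCurve_congr i (x, k) e1]] at d1
  rw [show (fun s => pauliCoord (centralDir L σ σ₄ (ringCoord L (P * sliceCurve i (x, k) hY0 hY00 s)) (Sum.inl (i, (x, k)))) 2) =
      fun s => pauliCoord (centralDir L σ σ₄ (ringCoord L (P * sliceCurve i (x, k) (halfPauli_conjTranspose 2) (halfPauli_trace 2) s)) (Sum.inl (i, (x, k)))) 2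
      from funext fun s => by rw [sliceCurve_congr i (x, k) e2]] at d2
  have hN : ((wrapBlock L k).card : ℝ) ≠ 0 := by exact_mod_cast (wrapBlock_nonempty (L := L) k).card_pos.ne'
  have hr : Real.sqrt (1 - ((blockIm L (wrapBlock L k) k P 0) ^ 2 + (blockIm L (wrapBlock L k) k P 1) ^ 2 + (blockIm L (wrapBlock L k) k P 2) ^ 2)) ≠ 0 :=
    (Real.sqrt_pos.2 (by linarith)).ne'
  exact ⟨_, _, _, d0, d1, d2, centralCoord_trace_algebra (su2Quat (P.1 i (x, k))) (blockIm L (wrapBlock L k) k P) (σ k) _ hN hr⟩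

/-! ## §4 The frame-derivative form (given differentiability of the coefficients) -/

/-- The tangent of the standard frame direction `(inl (i,e), a)` at a ring history is the slice tangent of `halfPauli a`. [folklore] -/
theorem mulTangent_stdFrame_inl (i : Fin (2 * L - 1 + 1)) (e : Edge 3 L) (a : Fin 3) (P : (Fin (2 * L - 1 + 1) → GaugeConfig 3 L SU2) × (Site 3 L → SU2)) :
    mulTangent (stdFrame (Sum.inl (i, e), a)) (ringCoord L P) = sliceTangent i e (halfPauli a) P := by
  rw [sliceTangent_eq]
  unfold mulTangent stdFrame
  refine Prod.ext ?_ ?_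
  · funext i' e'
    dsimp only
    simp only [sliceDir, Sum.inl.injEq, Prod.mk.injEq]
  · funext x'
    dsimp only
    simp

/-- ★ From differentiability of a coefficient to its frame derivative along a standard direction as an own-curve derivative (uniqueness of derivatives). [folklore] -/
theorem frameD_stdFrame_eq_of_hasDerivAt {f : ((Fin (2 * L - 1 + 1) → Edge 3 L → Matrix (Fin 2) (Fin 2) ℂ) × (Site 3 L → Matrix (Fin 2) (Fin 2) ℂ)) → ℝ}
    (i : Fin (2 * L - 1 + 1)) (e : Edge 3 L) (a : Fin 3) (P : (Fin (2 * L - 1 + 1) → GaugeConfig 3 L SU2) × (Site 3 L → SU2))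
    (hf : DifferentiableAt ℝ f (ringCoord L P)) {V : ℝ}
    (hV : HasDerivAt (fun s => f (ringCoord L (P * sliceCurve i e (halfPauli_conjTranspose a) (halfPauli_trace a) s))) V 0) :
    frameD (stdFrame (Sum.inl (i, e), a)) f (ringCoord L P) = V := by
  have hγ0 : P * sliceCurve i e (halfPauli_conjTranspose a) (halfPauli_trace a) 0 = P := by rw [sliceCurve_zero, mul_one]
  have hc := hasDerivAt_ringCoord_sliceCurve i e (halfPauli_conjTranspose a) (halfPauli_trace a) P 0
  have hf' : HasFDerivAt f (fderiv ℝ f (ringCoord L P)) (ringCoord L (P * sliceCurve i e (halfPauli_conjTranspose a) (halfPauli_trace a) 0)) := by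
    rw [hγ0]; exact hf.hasFDerivAt
  have h := hf'.comp_hasDerivAt (0 : ℝ) hc
  rw [hγ0] at h
  rw [frameD, mulTangent_stdFrame_inl]
  exact h.unique hV

/-- ★★★ **The per-variable divergence of the explicit central field at a wrap-block variable, frame form.**  If the three coordinates
`M ↦ pauliCoord (centralDir σ σ₄ M (i,(x,k))) a` are differentiable at `ringCoord P` (w2's `contDiff_centralCoeff`), then for `x_k = −1`, `|z_k(P)|² < ½`:
`Σ_a frameD (stdFrame ((i,(x,k)), a)) (coordinate a) (ringCoord P) = 3(σ_k r q₀ + z·p) − N⁻¹(3q₀² + 2|p|² + σ_k r⁻¹ q₀(z·p)) + (3/2)σ_k q₀/N` — for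
`fixVar v = inl (i,(x,k))` the left side is `Σ_a frameD (fixFrameStd (v,a)) (centralCoeff σ σ₄ (v,a)) (ringCoord P)` by `rfl`. [cite: CosteEtAl1985] -/
theorem centralDiv_wrap_eq (σ : Fin 3 → ℝ) (σ₄ : ℝ) (P : (Fin (2 * L - 1 + 1) → GaugeConfig 3 L SU2) × (Site 3 L → SU2))
    (i : Fin (2 * L - 1 + 1)) {x : Site 3 L} {k : Fin 3} (hx : x k = -1)
    (hz : (blockIm L (wrapBlock L k) k P 0) ^ 2 + (blockIm L (wrapBlock L k) k P 1) ^ 2 + (blockIm L (wrapBlock L k) k P 2) ^ 2 < 1 / 2)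
    (hdiff : ∀ a : Fin 3, DifferentiableAt ℝ (fun M => pauliCoord (centralDir L σ σ₄ M (Sum.inl (i, (x, k)))) a) (ringCoord L P)) :
    frameD (stdFrame (Sum.inl (i, (x, k)), 0)) (fun M => pauliCoord (centralDir L σ σ₄ M (Sum.inl (i, (x, k)))) 0) (ringCoord L P) +
      frameD (stdFrame (Sum.inl (i, (x, k)), 1)) (fun M => pauliCoord (centralDir L σ σ₄ M (Sum.inl (i, (x, k)))) 1) (ringCoord L P) +
      frameD (stdFrame (Sum.inl (i, (x, k)), 2)) (fun M => pauliCoord (centralDir L σ σ₄ M (Sum.inl (i, (x, k)))) 2) (ringCoord L P) =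
    3 * (σ k * Real.sqrt (1 - ((blockIm L (wrapBlock L k) k P 0) ^ 2 + (blockIm L (wrapBlock L k) k P 1) ^ 2 + (blockIm L (wrapBlock L k) k P 2) ^ 2)) * (su2Quat (P.1 i (x, k))).re + (blockIm L (wrapBlock L k) k P 0 * (su2Quat (P.1 i (x, k))).imI + blockIm L (wrapBlock L k) k P 1 * (su2Quat (P.1 i (x, k))).imJ + blockIm L (wrapBlock L k) k P 2 * (su2Quat (P.1 i (x, k))).imK)) - (3 * (su2Quat (P.1 i (x, k))).re ^ 2 + 2 * ((su2Quat (P.1 i (x, k))).imI ^ 2 + (su2Quat (P.1 i (x, k))).imJ ^ 2 + (su2Quat (P.1 i (x, k))).imK ^ 2) + σ k * (Real.sqrt (1 - ((blockIm L (wrapBlock L k) k P 0) ^ 2 + (blockIm L (wrapBlock L k) k P 1) ^ 2 + (blockIm L (wrapBlock L k) k P 2) ^ 2)))⁻¹ * (su2Quat (P.1 i (x, k))).re * (blockIm L (wrapBlock L k) k P 0 * (su2Quat (P.1 i (x, k))).imI + blockIm L (wrapBlock L k) k P 1 * (su2Quat (P.1 i (x, k))).imJ + blockIm L (wrapBlock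 L k) k P 2 * (su2Quat (P.1 i (x, k))).imK)) / ((wrapBlock L k).card : ℝ) + (3 / 2 : ℝ) * σ k * (su2Quat (P.1 i (x, k))).re / ((wrapBlock L k).card : ℝ) := by
  obtain ⟨V₀, V₁, V₂, h0, h1, h2, hsum⟩ := centralCoord_wrap_trace σ σ₄ P i hx hz
  rw [frameD_stdFrame_eq_of_hasDerivAt i (x, k) 0 P (hdiff 0) h0, frameD_stdFrame_eq_of_hasDerivAt i (x, k) 1 P (hdiff 1) h1,
    frameD_stdFrame_eq_of_hasDerivAt i (x, k) 2 P (hdiff 2) h2]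
  exact hsum

end Summit.QuantumFields.YangMills.Theorems.VirialFluxGap.CentralField

end
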